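import Mathlib
import HarnessLib
import Literature.NumberTheory.LFunctions.WeilGroundEnergyParitySplit
import Literature.NumberTheory.LFunctions.WeilWindowSuzukiProofs
import Summits.RiemannHypothesis.RiemannHypothesis.Theorems.WeilGroundStateArchimedeanWindowSimpleEven
import Summits.RiemannHypothesis.RiemannHypothesis.Theorems.WeilParityEvenWinsArchBumpEnergy
import Summits.RiemannHypothesis.RiemannHypothesis.Theorems.WeilParityEvenWinsArchBumpData
import Summits.RiemannHypothesis.RiemannHypothesis.Theorems.WeilParityEvenWinsArchOddFloor
import Summits.RiemannHypothesis.RiemannHypothesis.Theorems.WeilParityEvenWinsArchArchTail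
import Summits.RiemannHypothesis.RiemannHypothesis.Theorems.WeilParityEvenWinsArchPhiLipschitz
import Summits.RiemannHypothesis.RiemannHypothesis.Theorems.WeilParityEvenWinsArchDilationEnergy
import Summits.RiemannHypothesis.RiemannHypothesis.Theorems.WeilParityEvenWinsArchIncrementAverage

/-!
# `EvenWinsArch` — the even-sector ceilings and the seven rungs of the parity ladder

Route `RiemannHypothesis/WeilParity`, crux `EvenWinsArch` (stmt-RiemannHypothesis-15433), line `birth`
(registered skeleton `Cruxes/EvenWinsArch/Lines/birth.lean`): the three registered rung stubs
`stub_logLadder`, `stub_midLadder`, `stub_topLadder`, proved from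

* the even ceiling `stub_evenCeiling`: for `0 < r ≤ 1/3`,
  `ε(r) ≤ U(r) = 31/30 + 7r/12 + (10/3) r (1 + r²/36)² + 2 T(2r) − M`, `T(x) = ∫_{Ioi x} w`,
  `M = weilMarkovConstant ((log 2)/2)` — the tree's form-domain Rayleigh principle `stub_formDomainPos`
  applied to the rescaled bump `trialFun (x/(3r))` (`stub_bumpEnergy`, `stub_bumpData`);
* the odd floor `stub_oddFloor` (dilation transport of the kernel-checked `θ = 1/20` certificate):
  `ε_od(a) ≥ L(a) = 1/20 + 2 (T(2a) − T(log 2)) − 2 (sinh a − a) − ((log 2)/2 − a)`;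
* `2 (T(2w) − T(2w')) ≤ log(w'/w) + (w' − w)` (`Φ = t·w(t) ≤ 1/2 + t/4`), `T(log 2) ≤ 1.49686`
  (`stub_archTailLogTwo`), `M ≥ 5.367` (tree), and elementary bounds on `log (3/2)`, `log (5/3)`, `sinh`.

A rung `w → w'` is `U(w) < L(w')`; then `ε(w) < ε_od(w') ≤ ε_od(w)` forces `ε_ev(w) = ε(w)`
(`weilGroundEnergy_eq_min_even_odd`), whence `ε_ev(w) ≤ ε_od(w')`.
-/

namespace Summit.RiemannHypothesis.RiemannHypothesis.Theorems.WeilParity.EvenWinsArch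

-- `Summit.RiemannHypothesis.RiemannHypothesis.…` repeats a namespace component by design (D-0017 layout).
set_option linter.dupNamespace false

open Set MeasureTheory Filter
open Literature.NumberTheory.LFunctions
open Summit.RiemannHypothesis.RiemannHypothesis.Theorems.WeilGroundState

/-! ## The even ceiling -/

/-- **The even-sector ceiling (`stub_evenCeiling`).** For `0 < r ≤ 1/3`,
`ε(r) ≤ 31/30 + 7r/12 + (10/3) r (1 + r²/36)² + 2 ∫_{Ioi 2r} w − M_{(log 2)/2}`: the form-domain
Rayleigh quotient of the rescaled bump `trialFun (x/(3r))`. -/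
theorem stub_evenCeiling :
    ∀ r : ℝ, 0 < r → r ≤ 1 / 3 →
      Literature.NumberTheory.LFunctions.weilGroundEnergy r ≤
        31 / 30 + 7 / 12 * r + 10 / 3 * r * (1 + r ^ 2 / 36) ^ 2 +
            2 * (∫ t in Set.Ioi (2 * r), Literature.NumberTheory.LFunctions.weilArchDensity t) -
          Literature.NumberTheory.LFunctions.weilMarkovConstant (Real.log 2 / 2) := by
  intro r hr hr3
  obtain ⟨hmem, hvan, hnorm, hP⟩ := stub_bumpData r hr hr3
  obtain ⟨hint, hE⟩ := stub_bumpEnergy r hr hr3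
  have h := Summit.RiemannHypothesis.RiemannHypothesis.Theorems.WeilWindowFlowWindowLipschitz.stub_formDomainPos
    r hr _ hmem (Eventually.of_forall hvan) hint
  rw [hnorm] at h
  -- no prime enters: `M_r = M_{(log 2)/2}`
  have hM : weilMarkovConstant r = weilMarkovConstant (Real.log 2 / 2) := by
    have hzero : ∀ b : ℝ, b ≤ Real.log 2 / 2 →
        ∑ n ∈ weilPrimeIndex b, (ArithmeticFunction.vonMangoldt n : ℝ) / Real.sqrt n = 0 := by
      intro b hb
      refine Finset.sum_eq_zero fun n hn ↦ ?_
      rw [mem_weilPrimeIndex] at hn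
      rcases Nat.lt_or_ge n 2 with h2 | h2
      · interval_cases n <;> simp
      · exfalso
        have hlog : Real.log 2 ≤ Real.log n := Real.log_le_log two_pos (by exact_mod_cast h2)
        linarith
    have hr' : r ≤ Real.log 2 / 2 := by linarith [Real.log_two_gt_d9]
    unfold weilMarkovConstant
    rw [hzero r hr', hzero _ le_rfl]
  rw [hM] at h
  set T : ℝ := ∫ t in Set.Ioi (2 * r), weilArchDensity t
  set M : ℝ := weilMarkovConstant (Real.log 2 / 2)
  set X : ℝ := 31 / 30 + 7 / 12 * r + 10 / 3 * r * (1 + r ^ 2 / 36) ^ 2 + 2 * T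
  have hN : (0 : ℝ) < 16 / 15 * r := by positivity
  have hkey : (M + weilGroundEnergy r) * (16 / 15 * r) ≤ X * (16 / 15 * r) := by
    have e : 32 / 9 * r ^ 2 * (1 + r ^ 2 / 36) ^ 2 + (248 / 225 * r + 28 / 45 * r ^ 2 + 32 / 15 * r * T) =
        X * (16 / 15 * r) := by ring
    linarith
  have := le_of_mul_le_mul_right hkey hN
  linarith

/-! ## The kernel bound `Φ ≤ 1/2 + t/4` and the tail differences -/

/-- `Φ(t) = t·w(t) ≤ 1/2 + t/4` for `t > 0` (from the tree's Padé bound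
`2 t w(t) ≤ e^{-t/2}(1 + t + t²/3)` and `e^{t/2} ≥ 1 + t/2 + t²/8`). -/
theorem mul_weilArchDensity_le {t : ℝ} (ht : 0 < t) : t * weilArchDensity t ≤ 1 / 2 + t / 4 := by
  have hp := two_mul_mul_weilArchDensity_le ht
  have he : 1 + t / 2 + (t / 2) ^ 2 / 2 ≤ Real.exp (t / 2) := Real.quadratic_le_exp_of_nonneg (by linarith)
  have hpos : 0 < Real.exp (t / 2) := Real.exp_pos _
  have hinv : Real.exp (-(t / 2)) = (Real.exp (t / 2))⁻¹ := Real.exp_neg _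
  have h1 : Real.exp (-(t / 2)) * (1 + t + t ^ 2 / 3) ≤ 1 + t / 2 := by
    rw [hinv, inv_mul_le_iff₀ hpos]
    nlinarith
  linarith

/-- **Tail differences.** For `0 < x ≤ y`: `∫_{Ioi x} w − ∫_{Ioi y} w = ∫_{(x,y]} w ≤ ½ log(y/x) + (y − x)/4`
(`w(t) ≤ 1/(2t) + 1/4`). -/
theorem archTail_sub_le {x y : ℝ} (hx : 0 < x) (hxy : x ≤ y) :
    (∫ t in Set.Ioi x, weilArchDensity t) - (∫ t in Set.Ioi y, weilArchDensity t) ≤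
      1 / 2 * Real.log (y / x) + (y - x) / 4 := by
  have hy : 0 < y := lt_of_lt_of_le hx hxy
  have hIx := integrableOn_weilArchDensity_Ioi hx
  have hIxy : IntegrableOn weilArchDensity (Ioc x y) := hIx.mono_set Ioc_subset_Ioi_self
  have hIy : IntegrableOn weilArchDensity (Ioi y) := hIx.mono_set (Ioi_subset_Ioi hxy)
  have hsplit : (∫ t in Ioi x, weilArchDensity t) =
      (∫ t in Ioc x y, weilArchDensity t) + ∫ t in Ioi y, weilArchDensity t := by
    rw [← Ioc_union_Ioi_eq_Ioi hxy, setIntegral_union (Ioc_disjoint_Ioi le_rfl) measurableSet_Ioi hIxy hIy]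
  have hbound : (∫ t in Ioc x y, weilArchDensity t) ≤ ∫ t in Ioc x y, (1 / 2 * t⁻¹ + 1 / 4) := by
    have hc : IntegrableOn (fun t : ℝ ↦ 1 / 2 * t⁻¹ + 1 / 4) (Ioc x y) := by
      refine (ContinuousOn.integrableOn_Icc ?_).mono_set Ioc_subset_Icc_self
      exact ContinuousOn.add (continuousOn_const.mul (continuousOn_inv₀.mono fun t ht ↦
        (lt_of_lt_of_le hx ht.1).ne')) continuousOn_const
    refine setIntegral_mono_on hIxy hc measurableSet_Ioc fun t ht ↦ ?_
    have ht0 : 0 < t := lt_trans hx ht.1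
    have h := mul_weilArchDensity_le ht0
    rw [show weilArchDensity t = t⁻¹ * (t * weilArchDensity t) by field_simp]
    calc t⁻¹ * (t * weilArchDensity t) ≤ t⁻¹ * (1 / 2 + t / 4) :=
          mul_le_mul_of_nonneg_left h (inv_pos.2 ht0).le
      _ = 1 / 2 * t⁻¹ + 1 / 4 := by field_simp
  have heval : ∫ t in Ioc x y, (1 / 2 * t⁻¹ + 1 / 4) = 1 / 2 * Real.log (y / x) + (y - x) / 4 := by
    have hii : IntervalIntegrable (fun t : ℝ ↦ t⁻¹) volume x y := by
      refine intervalIntegral.intervalIntegrable_inv (fun t ht ↦ ?_) continuousOn_id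
      rw [uIcc_of_le hxy] at ht
      exact (lt_of_lt_of_le hx ht.1).ne'
    rw [← intervalIntegral.integral_of_le hxy, intervalIntegral.integral_add (hii.const_mul _)
      intervalIntegrable_const, intervalIntegral.integral_const_mul, integral_inv_of_pos hx hy,
      intervalIntegral.integral_const, smul_eq_mul]
    ring
  linarith

/-! ## Elementary numerical bounds -/

/-- `log (3/2) ≤ 0.4056`. -/
theorem log_three_halves_le : Real.log (3 / 2) ≤ 0.4056 := by
  rw [Real.log_le_iff_le_exp (by norm_num)]
  have h := Real.sum_le_exp_of_nonneg (x := (0.4056 : ℝ)) (by norm_num) 6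
  simp only [Finset.sum_range_succ, Finset.sum_range_zero, Nat.factorial] at h
  norm_num at h
  linarith

/-- `log (5/3) ≤ 0.511`. -/
theorem log_five_thirds_le : Real.log (5 / 3) ≤ 0.511 := by
  rw [Real.log_le_iff_le_exp (by norm_num)]
  have h := Real.sum_le_exp_of_nonneg (x := (0.511 : ℝ)) (by norm_num) 6
  simp only [Finset.sum_range_succ, Finset.sum_range_zero, Nat.factorial] at h
  norm_num at h
  linarith

/-- `log ((log 2)/(3/5)) ≤ 0.1444` (`(log 2)/0.6 < 1.1552454 ≤ e^{0.1444}`). -/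
theorem log_log_two_div_le : Real.log (Real.log 2 / (2 * (3 / 10))) ≤ 0.1444 := by
  have hl2 := Real.log_two_lt_d9
  have hl2' := Real.log_two_gt_d9
  rw [Real.log_le_iff_le_exp (by norm_num at hl2' ⊢; linarith)]
  have h := Real.sum_le_exp_of_nonneg (x := (0.1444 : ℝ)) (by norm_num) 5
  simp only [Finset.sum_range_succ, Finset.sum_range_zero, Nat.factorial] at h
  norm_num at h ⊢
  linarith

/-- `sinh x − x ≤ x³/6 + (5/96) x⁴` for `0 ≤ x ≤ 1` (Taylor bounds of `e^{±x}` to order 4). -/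
theorem sinh_sub_le {x : ℝ} (hx0 : 0 ≤ x) (hx1 : x ≤ 1) :
    Real.sinh x - x ≤ x ^ 3 / 6 + 5 / 96 * x ^ 4 := by
  have hax : |x| ≤ 1 := by rw [abs_of_nonneg hx0]; exact hx1
  have hanx : |(-x)| ≤ 1 := by rw [abs_neg]; exact hax
  have h1 := Real.exp_bound hax (n := 4) (by norm_num)
  have h2 := Real.exp_bound hanx (n := 4) (by norm_num)
  have h1' := (abs_sub_le_iff.1 h1).1
  have h2' := (abs_sub_le_iff.1 h2).2
  simp only [Finset.sum_range_succ, Finset.sum_range_zero, Nat.factorial] at h1' h2'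
  rw [abs_of_nonneg hx0] at h1'
  rw [abs_neg, abs_of_nonneg hx0] at h2'
  norm_num at h1' h2'
  rw [Real.sinh_eq]
  nlinarith [h1', h2']

/-! ## From `U(w) < L(w')` to a rung -/

/-- A strict comparison `ε(w) < ε_od(w')` with `w ≤ w'` gives the rung `ε_ev(w) ≤ ε_od(w')`:
`ε_od(w') ≤ ε_od(w)` (antitone), so `ε(w) < ε_od(w)` and `ε(w) = min(ε_ev, ε_od)(w)` is the even bottom. -/
theorem rung_of_lt {w w' : ℝ} (hw : 0 < w) (hww' : w ≤ w')
    (h : weilGroundEnergy w < weilOddGroundEnergy w') :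
    weilEvenGroundEnergy w ≤ weilOddGroundEnergy w' := by
  have hanti : weilOddGroundEnergy w' ≤ weilOddGroundEnergy w := weilOddGroundEnergy_antitone hw hww'
  have hmin := weilGroundEnergy_eq_min_even_odd w
  have hlt : weilGroundEnergy w < weilOddGroundEnergy w := lt_of_lt_of_le h hanti
  have hev : weilGroundEnergy w = weilEvenGroundEnergy w := by
    rw [hmin]
    exact min_eq_left (by
      by_contra hcon
      push Not at hcon
      rw [hmin, min_eq_right hcon.le] at hlt
      exact lt_irrefl _ hlt)
  rw [← hev]
  exact h.le

/-- The odd side of the top rung, in the tree: `1/20 ≤ ε_od((log 2)/2)` (the kernel-checked gap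
certificate `weilGapCert`, `θ = 1/20`). -/
theorem oddFloor_top : (1 / 20 : ℝ) ≤ weilOddGroundEnergy (Real.log 2 / 2) := by
  have ha : 0 < Real.log 2 / 2 := by have := Real.log_pos one_lt_two; positivity
  refine le_weilOddGroundEnergy_of_forall ha fun g hg hs hodd hn ↦ ?_
  have hθ := WeilGapCert.weilQuadratic_re_ge_of_checkG weilGapCert_checkG hg hs (Or.inl hodd)
  rw [hn, mul_one, show weilGapCert.theta = 1 / 20 from rfl] at hθ
  push_cast at hθ
  linarith

/-- **One generic rung.** For ladder points `0 < w ≤ w'` with `w ≤ 1/3`, `w' ≤ (log 2)/2`, `w' ≤ 1`, a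
numerical bound `log (w'/w) ≤ ℓ` and the elementary inequality
`31/30 + 7w/12 + (10/3) w (1 + w²/36)² + ℓ + (w' − w) + (2·1.49686 − 5.367) + 2 (w'³/6 + (5/96) w'⁴)
 + (0.3465736 − w') < 1/20`, the rung `ε_ev(w) ≤ ε_od(w')` holds. -/
theorem rung_of_numerics {w w' ℓ : ℝ} (hw : 0 < w) (hww' : w ≤ w') (hw3 : w ≤ 1 / 3)
    (hw'A : w' ≤ Real.log 2 / 2) (hw'1 : w' ≤ 1) (hlog : Real.log (w' / w) ≤ ℓ)
    (hnum : 31 / 30 + 7 / 12 * w + 10 / 3 * w * (1 + w ^ 2 / 36) ^ 2 + ℓ + (w' - w) +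
      (2 * 1.49686 - 5.367) + 2 * (w' ^ 3 / 6 + 5 / 96 * w' ^ 4) + (0.3465736 - w') < 1 / 20) :
    weilEvenGroundEnergy w ≤ weilOddGroundEnergy w' := by
  have hw' : 0 < w' := lt_of_lt_of_le hw hww'
  have hU := stub_evenCeiling w hw hw3
  have hL := stub_oddFloor w' hw' hw'A
  have hT := archTail_sub_le (x := 2 * w) (y := 2 * w') (by linarith) (by linarith)
  rw [show 2 * w' / (2 * w) = w' / w by field_simp] at hT
  have hTL := stub_archTailLogTwo
  have hM := weilMarkovConstant_log_two_half_ge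
  have hs := sinh_sub_le hw'.le hw'1
  have hl2 := Real.log_two_lt_d9
  refine rung_of_lt hw hww' ?_
  norm_num at hnum hTL hM hl2
  linarith

/-! ## The seven rungs -/

/-- Rung 1: `ε_ev(1/100) ≤ ε_od(3/200)`. -/
theorem rung1 : weilEvenGroundEnergy (1 / 100) ≤ weilOddGroundEnergy (3 / 200) :=
  rung_of_numerics (ℓ := 0.4056) (by norm_num) (by norm_num) (by norm_num)
    (by linarith [Real.log_two_gt_d9]) (by norm_num)
    (by rw [show (3 / 200 : ℝ) / (1 / 100) = 3 / 2 by norm_num]; exact log_three_halves_le)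
    (by norm_num)

/-- Rung 2: `ε_ev(3/200) ≤ ε_od(1/40)`. -/
theorem rung2 : weilEvenGroundEnergy (3 / 200) ≤ weilOddGroundEnergy (1 / 40) :=
  rung_of_numerics (ℓ := 0.511) (by norm_num) (by norm_num) (by norm_num)
    (by linarith [Real.log_two_gt_d9]) (by norm_num)
    (by rw [show (1 / 40 : ℝ) / (3 / 200) = 5 / 3 by norm_num]; exact log_five_thirds_le)
    (by norm_num)

/-- Rung 3: `ε_ev(1/40) ≤ ε_od(1/20)`. -/
theorem rung3 : weilEvenGroundEnergy (1 / 40) ≤ weilOddGroundEnergy (1 / 20) :=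
  rung_of_numerics (ℓ := 0.6931471808) (by norm_num) (by norm_num) (by norm_num)
    (by linarith [Real.log_two_gt_d9]) (by norm_num)
    (by rw [show (1 / 20 : ℝ) / (1 / 40) = 2 by norm_num]; exact Real.log_two_lt_d9.le)
    (by norm_num)

/-- Rung 4: `ε_ev(1/20) ≤ ε_od(1/10)`. -/
theorem rung4 : weilEvenGroundEnergy (1 / 20) ≤ weilOddGroundEnergy (1 / 10) :=
  rung_of_numerics (ℓ := 0.6931471808) (by norm_num) (by norm_num) (by norm_num)
    (by linarith [Real.log_two_gt_d9]) (by norm_num)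
    (by rw [show (1 / 10 : ℝ) / (1 / 20) = 2 by norm_num]; exact Real.log_two_lt_d9.le)
    (by norm_num)

/-- Rung 5: `ε_ev(1/10) ≤ ε_od(1/5)`. -/
theorem rung5 : weilEvenGroundEnergy (1 / 10) ≤ weilOddGroundEnergy (1 / 5) :=
  rung_of_numerics (ℓ := 0.6931471808) (by norm_num) (by norm_num) (by norm_num)
    (by linarith [Real.log_two_gt_d9]) (by norm_num)
    (by rw [show (1 / 5 : ℝ) / (1 / 10) = 2 by norm_num]; exact Real.log_two_lt_d9.le)
    (by norm_num)

/-- Rung 6: `ε_ev(1/5) ≤ ε_od(3/10)`. -/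
theorem rung6 : weilEvenGroundEnergy (1 / 5) ≤ weilOddGroundEnergy (3 / 10) :=
  rung_of_numerics (ℓ := 0.4056) (by norm_num) (by norm_num) (by norm_num)
    (by linarith [Real.log_two_gt_d9]) (by norm_num)
    (by rw [show (3 / 10 : ℝ) / (1 / 5) = 3 / 2 by norm_num]; exact log_three_halves_le)
    (by norm_num)

/-- Rung 7, even half: `ε_ev(3/10) ≤ 1/20` (the bump ceiling at `r = 3/10`; the odd floor of the tree
at `(log 2)/2` shows `ε(3/10) < ε_od(3/10)`, so the ceiling is the even bottom's). -/
theorem rung7_even : weilEvenGroundEnergy (3 / 10) ≤ 1 / 20 := by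
  have hw : (0 : ℝ) < 3 / 10 := by norm_num
  have hl2 := Real.log_two_lt_d9
  have hl2' := Real.log_two_gt_d9
  have hwA : (3 / 10 : ℝ) ≤ Real.log 2 / 2 := by linarith
  have hU := stub_evenCeiling (3 / 10) hw (by norm_num)
  have hT := archTail_sub_le (x := 2 * (3 / 10)) (y := Real.log 2) (by norm_num) (by linarith)
  have hlog := log_log_two_div_le
  have hTL := stub_archTailLogTwo
  have hM := weilMarkovConstant_log_two_half_ge
  have hlt : weilGroundEnergy (3 / 10) < 1 / 20 := by
    norm_num at hU hT hlog hTL hM ⊢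
    linarith
  have hodd : (1 / 20 : ℝ) ≤ weilOddGroundEnergy (3 / 10) :=
    oddFloor_top.trans (weilOddGroundEnergy_antitone hw hwA)
  have hmin := weilGroundEnergy_eq_min_even_odd (3 / 10)
  have hev : weilGroundEnergy (3 / 10) = weilEvenGroundEnergy (3 / 10) := by
    rw [hmin]
    refine min_eq_left ?_
    by_contra hcon
    push Not at hcon
    rw [hmin, min_eq_right hcon.le] at hlt
    linarith
  rw [← hev]
  exact hlt.le

/-! ## The three registered rung stubs -/

/-- **Stub 1 of line `birth` — LOG-KERNEL LADDER (rungs 1–3).** -/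
theorem stub_logLadder :
    Literature.NumberTheory.LFunctions.weilEvenGroundEnergy (1 / 100) ≤
        Literature.NumberTheory.LFunctions.weilOddGroundEnergy (3 / 200) ∧
      Literature.NumberTheory.LFunctions.weilEvenGroundEnergy (3 / 200) ≤
        Literature.NumberTheory.LFunctions.weilOddGroundEnergy (1 / 40) ∧
      Literature.NumberTheory.LFunctions.weilEvenGroundEnergy (1 / 40) ≤
        Literature.NumberTheory.LFunctions.weilOddGroundEnergy (1 / 20) :=
  ⟨rung1, rung2, rung3⟩

/-- **Stub 2 of line `birth` — TRANSITION LADDER (rungs 4–5).** -/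
theorem stub_midLadder :
    Literature.NumberTheory.LFunctions.weilEvenGroundEnergy (1 / 20) ≤
        Literature.NumberTheory.LFunctions.weilOddGroundEnergy (1 / 10) ∧
      Literature.NumberTheory.LFunctions.weilEvenGroundEnergy (1 / 10) ≤
        Literature.NumberTheory.LFunctions.weilOddGroundEnergy (1 / 5) :=
  ⟨rung4, rung5⟩

/-- **Stub 3 of line `birth` — TOP LADDER (rung 6 and the even half of rung 7).** -/
theorem stub_topLadder :
    Literature.NumberTheory.LFunctions.weilEvenGroundEnergy (1 / 5) ≤
        Literature.NumberTheory.LFunctions.weilOddGroundEnergy (3 / 10) ∧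
      Literature.NumberTheory.LFunctions.weilEvenGroundEnergy (3 / 10) ≤ 1 / 20 :=
  ⟨rung6, rung7_even⟩

end Summit.RiemannHypothesis.RiemannHypothesis.Theorems.WeilParity.EvenWinsArch
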